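import Literature.NumberTheory.Transcendental.RoySmallValueProp61
import Literature.NumberTheory.Transcendental.RoySmallValueStep2Core
import Literature.NumberTheory.Transcendental.RoySmallValueLevelGain
import HarnessLib

/-!
# Roy's small value estimate for `𝔾ₐ × 𝔾ₘ` — §7 Step 2 for a level package: every admissible family is small on `𝒵(P̃, Q)`, with the height gain

Topic `Literature/NumberTheory/Transcendental`. Part of the formalisation of the proof of Roy 2013,
Theorem 1.1 (named fact `roy2013_thm_1_1`, `RoySmallValueEstimates.lean`), seat B. Source: D. Roy,
*A small value estimate for `𝔾ₐ × 𝔾ₘ`*, Mathematika 59 (2013) 333–363 = arXiv:1301.0663, §6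
(Propositions 6.1, 6.2, 6.4) and §7, Step 2 (pp. 16–18 of the arXiv text):

> (Step 1) `𝒞_D = {P ∈ ℂ[X]_D ; ‖P‖ ≤ exp(2D^β), max_{i<⌊D^τ⌋} |𝒟ⁱP(θ)| ≤ exp(−D^ν/2)}` [...]
> **Prop. 6.1.** `h_𝒞(ℙ²) ≤ −TU + 3D²Y + 21 log(3) D³`. **Prop. 6.2.** [...]
> `h_𝒞(Z) ≤ C' h_𝒞(ℙ²)(Y deg Z + D h(Z))/(D²Y)` [...] **Prop. 2.4 / Step 2**
> `∑_{α∈Z} log sup{|P(α)| ; P ∈ 𝒞_D} ≤ h_{𝒞_D}(Z) − D h(Z) + 9 log(3) D deg(Z)`.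

For a level package `L : LevelPkg D P̃` (parallel seat) and Roy's convex body
`𝒞 = royBody D ξ η Y U T` (forms of degree `D` with `‖R‖ ≤ e^Y` and `|𝒟ⁱR(1,ξ,η)| ≤ e^{−U}`,
`i < T`) containing `P̃` and its companion `Q`, we combine

* `prop_6_1` (`|Φ(P̃, Q, R)| ≤ e^{−TU} N! (3e^Y)^N` for `R ∈ 𝒞`) and `step2_core`
  (`|c| ∏_j |R_j(α_j)|^{e_j} ≤ 2^{2k2^k} sup_𝒞|Φ|` for every family `R_j ∈ 𝒞`) into
  `step2_family_le`;
* the gain `height_le_log_leading_sup` (`RoySmallValueLevelGain`: the sup-normalised leading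
  constant `|c| ∏ ‖α_j‖^{De_j}` is `≥ exp((D/[K:ℚ]) ∑ e_j h_K(rep j))`) into the SUP-NORMALISED form
  with the height of `𝒵(P̃, Q)` on the favourable side:
  **`∏_j (|R_j(α_j)|/‖α_j‖^D)^{e_j} ≤ 2^{2k2^k} e^{−TU} N! (3e^Y)^N · exp(−(D/[K:ℚ]) ∑_j e_j h_K(rep j))`**
  (`step2_family_normalised_le`) — Roy's "`h_𝒞(Z) − D h(Z)`" for test families, the input of the
  orbit selection (`RoySmallValueOrbitSelection`).

Also: `royBody` is convex in Roy's sense and contains `0` (`royBody_convex`, `zero_mem_royBody`).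
Everything is proved; the one definition (`royBody`) has a body; no named facts.

## References

* [Roy2013] D. Roy, *A small value estimate for 𝔾ₐ × 𝔾ₘ*, Mathematika 59 (2013), 333–363
  (arXiv:1301.0663), Propositions 6.1, 6.2, 6.4, 2.4 and §7, Steps 1–2.
-/

noncomputable section

open MvPolynomial Finset Height

namespace Literature.NumberTheory.Transcendental

namespace Roy2013

open Nesterenko

/-! ### Roy's convex body `𝒞_D` -/

/-- **Roy's convex body** `𝒞 = {R ∈ ℂ[X]_D ; ‖R‖ ≤ e^Y, |𝒟ⁱR(1, ξ, η)| ≤ e^{−U} (i < T)}`.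
[cite: Roy2013, Proposition 6.1 (definition of `𝒞`) and §7, Step 1 (`𝒞_D`)] -/
def royBody (D : ℕ) (ξ η : ℂ) (Y U : ℝ) (T : ℕ) : Set CX :=
  {R | R.IsHomogeneous D ∧ maxNorm R ≤ Real.exp Y ∧
    ∀ i < T, ‖aeval ![1, ξ, η] (homD^[i] R)‖ ≤ Real.exp (-U)}

/-- Membership, unfolded. [folklore] -/
theorem mem_royBody {D : ℕ} {ξ η : ℂ} {Y U : ℝ} {T : ℕ} {R : CX} :
    R ∈ royBody D ξ η Y U T ↔ R.IsHomogeneous D ∧ maxNorm R ≤ Real.exp Y ∧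
      ∀ i < T, ‖aeval ![1, ξ, η] (homD^[i] R)‖ ≤ Real.exp (-U) := Iff.rfl

/-- `0 ∈ 𝒞`. [folklore] -/
theorem zero_mem_royBody (D : ℕ) (ξ η : ℂ) (Y U : ℝ) (T : ℕ) : (0 : CX) ∈ royBody D ξ η Y U T := by
  refine ⟨isHomogeneous_zero _ _ _, by rw [maxNorm_zero]; exact (Real.exp_pos _).le, fun i _ => ?_⟩
  rw [Function.iterate_fixed (map_zero homD) i, map_zero, norm_zero]
  exact (Real.exp_pos _).le

/-- **`𝒞` is convex in Roy's sense**: `aR + bS ∈ 𝒞` for `R, S ∈ 𝒞`, `|a| + |b| ≤ 1`.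
[cite: Roy2013, §2 (convex bodies) and Prop. 6.1] -/
theorem royBody_convex (D : ℕ) (ξ η : ℂ) (Y U : ℝ) (T : ℕ) :
    ∀ R ∈ royBody D ξ η Y U T, ∀ S ∈ royBody D ξ η Y U T, ∀ a b : ℂ, ‖a‖ + ‖b‖ ≤ 1 →
      a • R + b • S ∈ royBody D ξ η Y U T := by
  intro R hR S hS a b hab
  obtain ⟨hRh, hRn, hRv⟩ := hR
  obtain ⟨hSh, hSn, hSv⟩ := hS
  have ha : ‖a‖ ≤ 1 := by linarith [norm_nonneg b]
  have hb : ‖b‖ ≤ 1 := by linarith [norm_nonneg a]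
  refine ⟨?_, ?_, fun i hi => ?_⟩
  · rw [smul_eq_C_mul, smul_eq_C_mul]
    exact (hRh.C_mul a).add (hSh.C_mul b)
  · rw [smul_eq_C_mul, smul_eq_C_mul]
    calc maxNorm (C a * R + C b * S) ≤ maxNorm (C a * R) + maxNorm (C b * S) := maxNorm_add_le _ _
      _ = ‖a‖ * maxNorm R + ‖b‖ * maxNorm S := by rw [maxNorm_C_mul, maxNorm_C_mul]
      _ ≤ ‖a‖ * Real.exp Y + ‖b‖ * Real.exp Y := by
          gcongr
      _ = (‖a‖ + ‖b‖) * Real.exp Y := by ring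
      _ ≤ 1 * Real.exp Y := by gcongr
      _ = Real.exp Y := one_mul _
  · rw [iterate_homD_add, iterate_homD_smul, iterate_homD_smul, map_add, map_smul, map_smul]
    calc ‖a • aeval ![1, ξ, η] (homD^[i] R) + b • aeval ![1, ξ, η] (homD^[i] S)‖
        ≤ ‖a‖ * ‖aeval ![1, ξ, η] (homD^[i] R)‖ + ‖b‖ * ‖aeval ![1, ξ, η] (homD^[i] S)‖ := by
          refine (norm_add_le _ _).trans ?_
          rw [norm_smul, norm_smul]
      _ ≤ ‖a‖ * Real.exp (-U) + ‖b‖ * Real.exp (-U) := by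
          gcongr
          · exact hRv i hi
          · exact hSv i hi
      _ = (‖a‖ + ‖b‖) * Real.exp (-U) := by ring
      _ ≤ 1 * Real.exp (-U) := by gcongr
      _ = Real.exp (-U) := one_mul _

/-! ### Step 2 for a level package -/

namespace LevelPkg

variable {D : ℕ} {Pt : MvPolynomial (Fin 3) ℤ} (L : LevelPkg D Pt)

/-- `∑ e_i = D² ≤ 2^k` whenever `D² ≤ 2^k`. [folklore] -/
theorem sum_e_le_two_pow {k : ℕ} (hk : D ^ 2 ≤ 2 ^ k) : ∑ i, L.e i ≤ 2 ^ k := by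
  rw [L.hesum, L.hcard]; exact hk

/-- **Step 2, test-family form**: for `P̃, Q ∈ 𝒞 = royBody D ξ η Y U T` and every family
`R_j ∈ 𝒞`, `|c| ∏_j |R_j(α_j)|^{e_j} ≤ 2^{2k2^k} · e^{−TU} N! (3e^Y)^N` (`N = binom(3D+2, 2)`,
`D² ≤ 2^k`, `T ≤ binom(L'+2, 2)`, `L' ≤ D`, interpolation constant `≤ e^Y`).
[cite: Roy2013, Propositions 6.1, 2.3–2.4 and §7, Step 2] -/
theorem step2_family_le (hPt : (map (Int.castRingHom ℂ) Pt).IsHomogeneous D) {ξ η : ℂ}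
    (hη : η ≠ 0) {T Li : ℕ} (hTL : T ≤ (Li + 2).choose 2) (hLD : Li ≤ D) {Y U : ℝ} (hU : 0 ≤ U)
    (hY : (3 * (1 + ‖ξ‖ + ‖η‖⁻¹)) ^ Li * (4 * (Li + 1) : ℝ) ^ (Li + 2).choose 2 ≤ Real.exp Y)
    (hPmem : map (Int.castRingHom ℂ) Pt ∈ royBody D ξ η Y U T)
    (hQmem : map (Int.castRingHom ℂ) (levelQ D Pt L.t) ∈ royBody D ξ η Y U T)
    {k : ℕ} (hk : D ^ 2 ≤ 2 ^ k) (t : Fin L.m → CX) (ht : ∀ i, t i ∈ royBody D ξ η Y U T) :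
    ‖L.c‖ * ∏ i, ‖eval (L.α i) (t i)‖ ^ L.e i ≤
      2 ^ (2 * k * 2 ^ k) * (Real.exp (-(T * U)) *
        ((Fintype.card (PhiRow D)).factorial * (3 * Real.exp Y) ^ Fintype.card (PhiRow D))) := by
  have hB : ∀ R ∈ royBody D ξ η Y U T,
      ‖royPhi D L.M₁ L.M₂ L.σ ![map (Int.castRingHom ℂ) Pt, map (Int.castRingHom ℂ) (levelQ D Pt L.t), R]‖ ≤
        Real.exp (-(T * U)) *
          ((Fintype.card (PhiRow D)).factorial * (3 * Real.exp Y) ^ Fintype.card (PhiRow D)) := by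
    intro R hR
    refine prop_6_1 hη hTL hLD hU hY L.hM₁ L.hM₂ L.σ (fun j => ?_) (fun j => ?_) (fun j => ?_)
    · fin_cases j
      · exact hPt
      · exact isHomogeneous_map_levelQ hPt L.t
      · exact hR.1
    · fin_cases j
      · exact hPmem.2.1
      · exact hQmem.2.1
      · exact hR.2.1
    · fin_cases j
      · exact hPmem.2.2
      · exact hQmem.2.2
      · exact hR.2.2
  exact step2_core L.hM₁ L.hM₂ L.σ L.hc L.hFeq (royBody_convex D ξ η Y U T)
    ⟨0, zero_mem_royBody D ξ η Y U T⟩ (fun R hR => hR.1) hB k (L.sum_e_le_two_pow hk) t ht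

/-- **Step 2, sup-normalised form with the height gain**: for every family `R_j ∈ 𝒞`,
`∏_j (|R_j(α_j)|/‖α_j‖^D)^{e_j} ≤ 2^{2k2^k} e^{−TU} N! (3e^Y)^N · exp(−(1/[K:ℚ]) ∑_j e_j D h_K(rep j))`.
[cite: Roy2013, Propositions 2.3, 2.4, 6.1, 6.2 and §7, Step 2 ("`h_𝒞(Z) − D h(Z)`")] -/
theorem step2_family_normalised_le (hPt : (map (Int.castRingHom ℂ) Pt).IsHomogeneous D)
    {ξ η : ℂ} (hη : η ≠ 0) {T Li : ℕ} (hTL : T ≤ (Li + 2).choose 2) (hLD : Li ≤ D) {Y U : ℝ}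
    (hU : 0 ≤ U)
    (hY : (3 * (1 + ‖ξ‖ + ‖η‖⁻¹)) ^ Li * (4 * (Li + 1) : ℝ) ^ (Li + 2).choose 2 ≤ Real.exp Y)
    (hPmem : map (Int.castRingHom ℂ) Pt ∈ royBody D ξ η Y U T)
    (hQmem : map (Int.castRingHom ℂ) (levelQ D Pt L.t) ∈ royBody D ξ η Y U T)
    {k : ℕ} (hk : D ^ 2 ≤ 2 ^ k) (K : IntermediateField ℚ ℂ) (hK : ∀ i k, L.α i k ∈ K)
    [Normal ℚ K] [NumberField K] (t : Fin L.m → CX) (ht : ∀ i, t i ∈ royBody D ξ η Y U T) :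
    ∏ i, (‖eval (L.α i) (t i)‖ / ‖L.α i‖ ^ D) ^ L.e i ≤
      2 ^ (2 * k * 2 ^ k) * (Real.exp (-(T * U)) *
        ((Fintype.card (PhiRow D)).factorial * (3 * Real.exp Y) ^ Fintype.card (PhiRow D))) *
        Real.exp (-((∑ i, (L.e i : ℝ) * (D * logHeight ((L.cfg K hK).rep i))) /
          Module.finrank ℚ K)) := by
  -- abbreviations
  obtain ⟨S₀, hS₀⟩ : ∃ S₀ : ℝ, S₀ = 2 ^ (2 * k * 2 ^ k) * (Real.exp (-(T * U)) *
      ((Fintype.card (PhiRow D)).factorial * (3 * Real.exp Y) ^ Fintype.card (PhiRow D))) :=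
    ⟨_, rfl⟩
  obtain ⟨Hs, hHs⟩ : ∃ Hs : ℝ, Hs = ∑ i, (L.e i : ℝ) * (D * logHeight ((L.cfg K hK).rep i)) :=
    ⟨_, rfl⟩
  obtain ⟨A, hA⟩ : ∃ A : ℝ, A = ∏ i, ‖L.α i‖ ^ (D * L.e i) := ⟨_, rfl⟩
  rw [← hS₀, ← hHs]
  have hcore := L.step2_family_le hPt hη hTL hLD hU hY hPmem hQmem hk t ht
  rw [← hS₀] at hcore
  have hc : 0 < ‖L.c‖ := norm_pos_iff.mpr L.hc
  have hαpos : ∀ i, 0 < ‖L.α i‖ := fun i => norm_pos_iff.mpr (L.α_ne_zero i)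
  have hA0 : 0 < A := by rw [hA]; exact prod_pos fun i _ => pow_pos (hαpos i) _
  have hn : (0 : ℝ) < Module.finrank ℚ K := by exact_mod_cast Module.finrank_pos
  -- the gain: `exp(Hs/n) ≤ ‖c‖ * A`
  have hgain := L.height_le_log_leading_sup K hK
  rw [← hHs] at hgain
  have hlogA : Real.log A = D * ∑ i, (L.e i : ℝ) * Real.log ‖L.α i‖ := by
    rw [hA, Real.log_prod (s := univ) (fun i _ => (pow_pos (hαpos i) _).ne'), mul_sum]
    refine Finset.sum_congr rfl fun i _ => ?_
    rw [Real.log_pow, Nat.cast_mul]; ring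
  have hexp : Real.exp (Hs / Module.finrank ℚ K) ≤ ‖L.c‖ * A := by
    have h1 : Hs / Module.finrank ℚ K ≤ Real.log ‖L.c‖ + Real.log A := by
      rw [div_le_iff₀ hn, hlogA]; linarith
    calc Real.exp (Hs / Module.finrank ℚ K) ≤ Real.exp (Real.log ‖L.c‖ + Real.log A) :=
          Real.exp_le_exp.mpr h1
      _ = ‖L.c‖ * A := by rw [Real.exp_add, Real.exp_log hc, Real.exp_log hA0]
  -- rewrite the left-hand side
  have hL : ∏ i, (‖eval (L.α i) (t i)‖ / ‖L.α i‖ ^ D) ^ L.e i =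
      (∏ i, ‖eval (L.α i) (t i)‖ ^ L.e i) / A := by
    rw [hA, ← prod_div_distrib]
    refine Finset.prod_congr rfl fun i _ => ?_
    rw [div_pow, ← pow_mul]
  rw [hL, div_le_iff₀ hA0]
  -- `∏ ≤ S₀/‖c‖` and `S₀/‖c‖ ≤ S₀ exp(-Hs/n) A`
  have h1 : ∏ i, ‖eval (L.α i) (t i)‖ ^ L.e i ≤ S₀ / ‖L.c‖ := by
    rw [le_div_iff₀ hc, mul_comm]; exact hcore
  have hS₀0 : 0 ≤ S₀ := by rw [hS₀]; positivity
  have h2 : S₀ / ‖L.c‖ ≤ S₀ * Real.exp (-(Hs / Module.finrank ℚ K)) * A := by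
    rw [Real.exp_neg, div_le_iff₀ hc]
    have h3 : S₀ * (Real.exp (Hs / Module.finrank ℚ K))⁻¹ * A * ‖L.c‖ =
        S₀ * ((‖L.c‖ * A) / Real.exp (Hs / Module.finrank ℚ K)) := by
      field_simp
    rw [h3]
    refine le_mul_of_one_le_right hS₀0 ?_
    rw [one_le_div (Real.exp_pos _)]
    exact hexp
  exact h1.trans h2

end LevelPkg

end Roy2013

end Literature.NumberTheory.Transcendental
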